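import Summits.KontsevichZagierPeriods.KontsevichZagierPeriods.Theorems.RootDecompRationalCubeDichotomyRankDescentP04

/-! # `RootDecompRationalCubeDichotomyRankDescentP05` — part 5/14 of the mechanical ≤400-line split of `RankDescent_v12_landing.lean` (sha256 00885b8b9882f02e…)
Source: decomp-kz lens-2 g13 `RankDescent_v12.lean` (HOME/decomp-kz-lens-2/g13/, sha256 00885b8b…; critic g5-18…g5-66 CLEARED as NODE v1–v12 for crux stmt-KontsevichZagierPeriods-26322 RationalCubePiKernelSingle: rank dichotomy single_of_fullRankGeTwo + RankLeOneKernel, de Rham-exact descent, linear-in-one-variable / hyperbola / Fermat–hyperbolic / conic classes, transport kit, Brieskorn module; writer g7 l.1222: «landing split §0–4 ∣ … ∣ §16 --supports 26322 endorsed»); `#print axioms` pins removed; landed by census-1 g9.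
Split by census-1 g9 `gen/splitlean.py`: scopes re-opened with their `open`/`variable`/`set_option` context; mathematics and declaration order unchanged. -/

noncomputable section
open MeasureTheory Set MvPolynomial
open Literature.NumberTheory.Transcendental
open Literature.NumberTheory.Transcendental.KZ
namespace Summit.KontsevichZagierPeriods.RootDecompRationalCubeDichotomy.Rung26322.RankDescent
variable {M : ℕ}

open MeasureTheory Set MvPolynomial in
open Literature.NumberTheory.Transcendental in
open Literature.NumberTheory.Transcendental.KZ in
/-- `∂_k`-antiderivatives exist in `ℚ[x]`. [folklore] -/
private theorem exists_pderiv_eq (k : Fin M) (P : MvPolynomial (Fin M) ℚ) :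
    ∃ G : MvPolynomial (Fin M) ℚ, pderiv k G = P := by
  have hv : (Pi.single k (1:ℚ) : Fin M → ℚ) ≠ 0 := by
    intro h
    have := congrFun h k
    simp at this
  obtain ⟨G, hG⟩ := exists_dirD_eq (Pi.single k (1:ℚ)) hv P
  refine ⟨G, ?_⟩
  have hs : (∑ j, (Pi.single k (1:ℚ) : Fin M → ℚ) j • (pderiv j G : MvPolynomial (Fin M) ℚ)) = pderiv k G := by
    rw [Finset.sum_eq_single k (fun j _ hj => by simp [hj])
      (fun h => (h (Finset.mem_univ k)).elim)]
    simp
  rw [dirD_apply, hs] at hG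
  exact hG

open MeasureTheory Set MvPolynomial in
open Literature.NumberTheory.Transcendental in
open Literature.NumberTheory.Transcendental.KZ in
/-- Soundness: congruent formal combinations have equal values. [cite: KontsevichZagier2001, §1.2] -/
private theorem eval_eq_of_sub_mem {x y : FormalRep} (h : x - y ∈ relations) : eval x = eval y := by
  have h' := relations_le_ker_eval_holds h
  rw [AddMonoidHom.mem_ker, map_sub] at h'
  exact sub_eq_zero.1 h'

/-- `∂_{i+1}` commutes with the shift of variables. [folklore] -/
theorem pderiv_succ_rename_succ {n : ℕ} (i : Fin n) (F : MvPolynomial (Fin n) ℚ) :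
    pderiv (Fin.succ i) (rename Fin.succ F) = rename Fin.succ (pderiv i F) := by
  induction F using MvPolynomial.induction_on with
  | C a => simp
  | add p q hp hq => simp [hp, hq]
  | mul_X p j hp =>
    rw [map_mul, rename_X, Derivation.leibniz, Derivation.leibniz, hp, smul_eq_mul, smul_eq_mul,
      smul_eq_mul, smul_eq_mul, map_add, map_mul, map_mul, rename_X]
    by_cases hij : j = i
    · subst hij
      rw [pderiv_X_self, pderiv_X_self, map_one]
    · rw [pderiv_X_of_ne hij, pderiv_X_of_ne (fun h => hij (Fin.succ_injective _ h)), map_zero]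

/-- Division by a monic linear form in `x₀`: `P = (x₀ + A)·q + ρ` with `ρ` free of `x₀`. [folklore] -/
theorem exists_monicLinear_div {n : ℕ} (A₀ : MvPolynomial (Fin n) ℚ) (P : MvPolynomial (Fin (n + 1)) ℚ) :
    ∃ q ρ₀ : _, P = (X 0 + rename Fin.succ A₀) * q + rename Fin.succ ρ₀ := by
  induction P using MvPolynomial.induction_on with
  | C a => exact ⟨0, C a, by simp⟩
  | add p p' hp hp' =>
    obtain ⟨q, ρ, h⟩ := hp
    obtain ⟨q', ρ', h'⟩ := hp'
    exact ⟨q + q', ρ + ρ', by rw [h, h', map_add]; ring⟩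
  | mul_X p j hp =>
    obtain ⟨q, ρ, h⟩ := hp
    refine Fin.cases ?_ (fun j₀ => ?_) j
    · refine ⟨q * X 0 + rename Fin.succ ρ, -(ρ * A₀), ?_⟩
      rw [h, map_neg, map_mul]
      ring
    · refine ⟨q * X (Fin.succ j₀), ρ * X j₀, ?_⟩
      rw [h, map_mul, rename_X]
      ring

/-- The summand of the exactness identity (`s = 0`) as a function of the potential. [folklore] -/
def exS {m : ℕ} (Q : MvPolynomial (Fin m) ℚ) (k : Fin m) (g : MvPolynomial (Fin m) ℚ) :
    MvPolynomial (Fin m) ℚ :=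
  pderiv k g * Q - C (((0 : ℕ) : ℚ) + 1) * (g * pderiv k Q)

/-- Auxiliary step `exS_zero`: ex S zero. [bookkeeping] -/
theorem exS_zero {m : ℕ} (Q : MvPolynomial (Fin m) ℚ) (k : Fin m) : exS Q k 0 = 0 := by
  simp [exS]

/-- Auxiliary step `exS_add`: ex S add. [bookkeeping] -/
theorem exS_add {m : ℕ} (Q : MvPolynomial (Fin m) ℚ) (k : Fin m) (a b : MvPolynomial (Fin m) ℚ) :
    exS Q k (a + b) = exS Q k a + exS Q k b := by
  simp only [exS, map_add]
  ring

/-- Auxiliary step `sum_exS_single`: sum ex S single. [bookkeeping] -/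
theorem sum_exS_single {m : ℕ} (Q : MvPolynomial (Fin m) ℚ) (j : Fin m) (g : MvPolynomial (Fin m) ℚ) :
    (∑ k, exS Q k ((Pi.single j g : Fin m → MvPolynomial (Fin m) ℚ) k)) = exS Q j g := by
  rw [Finset.sum_eq_single j (fun k _ hk => by rw [Pi.single_eq_of_ne hk, exS_zero])
    (fun h => (h (Finset.mem_univ j)).elim), Pi.single_eq_same]

/-- Auxiliary step `sum_exS_eq`: sum ex S eq. [bookkeeping] -/
theorem sum_exS_eq {m : ℕ} (Q : MvPolynomial (Fin m) ℚ) (G : Fin m → MvPolynomial (Fin m) ℚ) :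
    (∑ k, (pderiv k (G k) * Q - C (((0 : ℕ) : ℚ) + 1) * (G k * pderiv k Q))) = ∑ k, exS Q k (G k) := rfl

/-- **Every `P/(x₀ + A(x'))` is exact** (`n ≥ 1` witnessed by `i₀`). [folklore] -/
theorem drExact_of_monicLinear {n : ℕ} (i₀ : Fin n) (A₀ : MvPolynomial (Fin n) ℚ)
    (P : MvPolynomial (Fin (n + 1)) ℚ) : DRExact P (X 0 + rename Fin.succ A₀) := by
  obtain ⟨q, ρ₀, hP⟩ := exists_monicLinear_div A₀ P
  obtain ⟨G₀, hG₀⟩ := exists_pderiv_eq (0 : Fin (n + 1)) q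
  obtain ⟨Φ₀, hΦ₀⟩ := exists_pderiv_eq i₀ ρ₀
  have hA0 : pderiv 0 (rename Fin.succ A₀) = 0 := pderiv_zero_rename_succ A₀
  have hΦ0 : pderiv 0 (rename Fin.succ Φ₀) = 0 := pderiv_zero_rename_succ Φ₀
  have hΦi : pderiv (Fin.succ i₀) (rename Fin.succ Φ₀) = rename Fin.succ ρ₀ := by
    rw [pderiv_succ_rename_succ, hΦ₀]
  have hAi0 : pderiv 0 (pderiv (Fin.succ i₀) (rename Fin.succ A₀)) = 0 := by
    rw [pderiv_succ_rename_succ]; exact pderiv_zero_rename_succ _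
  have hX0i : pderiv (Fin.succ i₀) (X 0 : MvPolynomial (Fin (n + 1)) ℚ) = 0 :=
    pderiv_X_of_ne (Fin.succ_ne_zero i₀).symm
  obtain ⟨g0, hg0⟩ : ∃ g0 : MvPolynomial (Fin (n + 1)) ℚ, g0 = G₀ * (X 0 + rename Fin.succ A₀) -
      rename Fin.succ Φ₀ * pderiv (Fin.succ i₀) (rename Fin.succ A₀) := ⟨_, rfl⟩
  refine ⟨0, fun k => (Pi.single (0 : Fin (n + 1)) g0 : Fin (n + 1) → MvPolynomial (Fin (n + 1)) ℚ) k +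
    (Pi.single (Fin.succ i₀) (rename Fin.succ Φ₀) : Fin (n + 1) → MvPolynomial (Fin (n + 1)) ℚ) k, ?_⟩
  rw [sum_exS_eq]
  simp only [exS_add, Finset.sum_add_distrib, sum_exS_single]
  simp only [exS, hg0, Nat.cast_zero, zero_add, map_one, one_mul, pow_one, map_sub, map_add,
    Derivation.leibniz, smul_eq_mul, pderiv_X_self, hA0, hΦ0, hAi0, hX0i, hΦi, hG₀, mul_zero,
    add_zero, zero_add, mul_one]
  rw [hP]
  ring

/-- Rescaling the integrand data: `P/Q = (P/c)/(Q/c)`. [folklore] -/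
theorem integrand_rescale {m : ℕ} {q : IntegralRep m} {P Q : MvPolynomial (Fin m) ℚ} {D : Set (Fin m → ℝ)}
    (c : ℚ) (hc : c ≠ 0)
    (hf : ∀ z ∈ D, q.integrand z = MvPolynomial.aeval z P / MvPolynomial.aeval z Q) :
    ∀ z ∈ D, q.integrand z = MvPolynomial.aeval z (C c⁻¹ * P) / MvPolynomial.aeval z (C c⁻¹ * Q) := by
  intro z hz
  rw [hf z hz, map_mul, map_mul, MvPolynomial.algHom_C, mul_div_mul_left]
  simpa using hc

/-- Auxiliary step `zeroFree_rescale`: zero Free rescale. [bookkeeping] -/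
theorem zeroFree_rescale {m : ℕ} {Q : MvPolynomial (Fin m) ℚ} {D : Set (Fin m → ℝ)} (c : ℚ) (hc : c ≠ 0)
    (hQ : ∀ z ∈ D, MvPolynomial.aeval z Q ≠ 0) :
    ∀ z ∈ D, MvPolynomial.aeval z (C c⁻¹ * Q) ≠ 0 := by
  intro z hz
  rw [map_mul, MvPolynomial.algHom_C]
  exact mul_ne_zero (by simpa using hc) (hQ z hz)

/-- Auxiliary step `rescale_linear`: rescale linear. [bookkeeping] -/
theorem rescale_linear {n : ℕ} (c : ℚ) (hc : c ≠ 0) (A₀ : MvPolynomial (Fin n) ℚ) :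
    C c⁻¹ * (C c * X 0 + rename Fin.succ A₀) = X 0 + rename Fin.succ (C c⁻¹ * A₀) := by
  rw [map_mul, rename_C, mul_add, ← mul_assoc, ← map_mul, inv_mul_cancel₀ hc, map_one, one_mul]

/-- The exact branch of the graded step, factored: exact data at dimension `m+1` over a solved
dimension `m`. [cite: KontsevichZagier2001, §1.2 rules (1),(3)] -/
theorem single_of_exact {m : ℕ} (ih : SingleAt m) (q : IntegralRep (m + 1))
    (P Q : MvPolynomial (Fin (m + 1)) ℚ) (s : ℕ) (G : Fin (m + 1) → MvPolynomial (Fin (m + 1)) ℚ)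
    (hid : P * Q ^ (s + 1) =
      ∑ k, (MvPolynomial.pderiv k (G k) * Q - C ((s : ℚ) + 1) * (G k * MvPolynomial.pderiv k Q)))
    (hd : q.domain = Set.pi Set.univ (fun _ : Fin (m + 1) => Set.Icc (0:ℝ) 1))
    (hQ : ∀ z ∈ Set.pi Set.univ (fun _ : Fin (m + 1) => Set.Icc (0:ℝ) 1), MvPolynomial.aeval z Q ≠ 0)
    (hf : ∀ z ∈ Set.pi Set.univ (fun _ : Fin (m + 1) => Set.Icc (0:ℝ) 1),
      q.integrand z = MvPolynomial.aeval z P / MvPolynomial.aeval z Q)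
    (h0 : q.value = 0) : ∃ N : ℕ, (fun y : FormalRep => of piRep * y)^[N] (of q) ∈ relations := by
  obtain ⟨U, hqU⟩ := exact_reduct q P Q s G hid hd hQ hf
  have hval : U.rep.value = 0 := by
    rw [← eval_of, ← eval_eq_of_sub_mem hqU, eval_of, h0]
  obtain ⟨N, hN⟩ := ih U.rep U.num U.den (by rw [RFun.rep_domain, KZ.cube_eq_pi])
    (fun z hz => U.den_ne z (by rw [KZ.cube_eq_pi]; exact hz)) (fun z _ => rfl) hval
  refine ⟨N, ?_⟩
  have : of q = (of q - KZ.of U.rep) + KZ.of U.rep := by abel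
  rw [this, iterate_piMul_add]
  exact add_mem (piRep_mul_iterate_mem_relations N hqU) hN

/-- **Reduction (PROVED): denominators linear in `x₀` at dimension `n+1 ≥ 2` reduce to 26322 at
dimension `n`.** [cite: KontsevichZagier2001, §1.2 rules (1),(3)] -/
theorem linearVar_single_of_singleAt {n : ℕ} (i₀ : Fin n) (ih : SingleAt n) (c : ℚ) (hc : c ≠ 0)
    (A₀ : MvPolynomial (Fin n) ℚ) (q : IntegralRep (n + 1)) (P : MvPolynomial (Fin (n + 1)) ℚ)
    (hd : q.domain = Set.pi Set.univ (fun _ : Fin (n + 1) => Set.Icc (0:ℝ) 1))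
    (hQ : ∀ z ∈ Set.pi Set.univ (fun _ : Fin (n + 1) => Set.Icc (0:ℝ) 1),
      MvPolynomial.aeval z (C c * X 0 + rename Fin.succ A₀) ≠ 0)
    (hf : ∀ z ∈ Set.pi Set.univ (fun _ : Fin (n + 1) => Set.Icc (0:ℝ) 1),
      q.integrand z = MvPolynomial.aeval z P / MvPolynomial.aeval z (C c * X 0 + rename Fin.succ A₀))
    (h0 : q.value = 0) : ∃ N : ℕ, (fun y : FormalRep => of piRep * y)^[N] (of q) ∈ relations := by
  have hf' := integrand_rescale c hc hf
  have hQ' := zeroFree_rescale c hc hQ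
  rw [rescale_linear c hc] at hf' hQ'
  obtain ⟨s, G, hid⟩ := drExact_of_monicLinear i₀ (C c⁻¹ * A₀) (C c⁻¹ * P)
  exact single_of_exact ih q _ _ s G hid hd hQ' hf' h0

/-- **DECIDED CLASS (m = 2, PROVED, N = 0): `[ [0,1]², P(x,y)/(c·x + A(y)) ]`.** Every rational
representation on the square whose denominator is linear in `x` with constant leading coefficient,
zero-free on the square, with value `0`, lies in `relations`. [cite: KontsevichZagier2001, §1.2] -/
theorem linearVar_two_mem_relations (c : ℚ) (hc : c ≠ 0) (A₀ : MvPolynomial (Fin 1) ℚ)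
    (q : IntegralRep 2) (P : MvPolynomial (Fin 2) ℚ)
    (hd : q.domain = Set.pi Set.univ (fun _ : Fin 2 => Set.Icc (0:ℝ) 1))
    (hQ : ∀ z ∈ Set.pi Set.univ (fun _ : Fin 2 => Set.Icc (0:ℝ) 1),
      MvPolynomial.aeval z (C c * X 0 + rename Fin.succ A₀) ≠ 0)
    (hf : ∀ z ∈ Set.pi Set.univ (fun _ : Fin 2 => Set.Icc (0:ℝ) 1),
      q.integrand z = MvPolynomial.aeval z P / MvPolynomial.aeval z (C c * X 0 + rename Fin.succ A₀))
    (h0 : q.value = 0) : of q ∈ relations := by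
  have hf' := integrand_rescale c hc hf
  have hQ' := zeroFree_rescale c hc hQ
  rw [rescale_linear c hc] at hf' hQ'
  obtain ⟨s, G, hid⟩ := drExact_of_monicLinear (0 : Fin 1) (C c⁻¹ * A₀) (C c⁻¹ * P)
  exact mem_relations_of_exact_two q _ _ s G hid hd hQ' hf' h0

/-- **m = 3 linear-variable denominators ⟸ the `m ≤ 2` programme (PROVED edge).** [cite: KontsevichZagier2001, §1.2] -/
theorem linearVar_three_of_dimTwo
    (h2 : Summit.KontsevichZagierPeriods.KontsevichZagierPeriods.Theses.HodgeLevel.DimTwoRationalStratum)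
    (c : ℚ) (hc : c ≠ 0) (A₀ : MvPolynomial (Fin 2) ℚ) (q : IntegralRep 3) (P : MvPolynomial (Fin 3) ℚ)
    (hd : q.domain = Set.pi Set.univ (fun _ : Fin 3 => Set.Icc (0:ℝ) 1))
    (hQ : ∀ z ∈ Set.pi Set.univ (fun _ : Fin 3 => Set.Icc (0:ℝ) 1),
      MvPolynomial.aeval z (C c * X 0 + rename Fin.succ A₀) ≠ 0)
    (hf : ∀ z ∈ Set.pi Set.univ (fun _ : Fin 3 => Set.Icc (0:ℝ) 1),
      q.integrand z = MvPolynomial.aeval z P / MvPolynomial.aeval z (C c * X 0 + rename Fin.succ A₀))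
    (h0 : q.value = 0) : ∃ N : ℕ, (fun y : FormalRep => of piRep * y)^[N] (of q) ∈ relations :=
  linearVar_single_of_singleAt (0 : Fin 2) (singleAt_of_dimTwoRationalStratum h2 le_rfl) c hc A₀ q P hd hQ hf h0

/-- A concrete member of the decided class with FULL-RANK denominator: `x + 2 + y²`. [folklore] -/
theorem linearVar_example_fullRank (v : Fin 2 → ℚ)
    (hv : (∑ k, v k • MvPolynomial.pderiv k ((C 1 * X 0 + rename Fin.succ (C 2 + X 0 ^ 2) :
      MvPolynomial (Fin 2) ℚ))) = 0) : v = 0 := by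
  have h10 : rename Fin.succ (C 2 + X 0 ^ 2 : MvPolynomial (Fin 1) ℚ) =
      (C 2 + X 1 ^ 2 : MvPolynomial (Fin 2) ℚ) := by
    simp [rename_X]
  rw [h10] at hv
  have hsum : (∑ k, v k • MvPolynomial.pderiv k ((C 1 * X 0 + (C 2 + X 1 ^ 2) : MvPolynomial (Fin 2) ℚ))) =
      C (v 0) + 2 * (C (v 1) * X 1) := by
    simp only [Fin.sum_univ_two, map_add, map_one, one_mul, Derivation.leibniz_pow, pderiv_C,
      pderiv_X_self, pderiv_one_X_zero, pderiv_zero_X_one, smul_eq_mul, nsmul_eq_mul,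
      MvPolynomial.smul_eq_C_mul, zero_add, add_zero, mul_one, mul_zero, Nat.cast_ofNat]
    ring
  rw [hsum] at hv
  have h0 : v 0 = 0 := by
    have := congrArg (MvPolynomial.eval (fun _ : Fin 2 => (0:ℚ))) hv
    simpa using this
  have h1 : v 1 = 0 := by
    have := congrArg (MvPolynomial.eval (fun _ : Fin 2 => (1:ℚ))) hv
    simp [h0] at this
    exact this
  funext i
  fin_cases i
  · exact h0
  · exact h1

/-! ## §7 (v3) By-name closures and the CORNER criterion

(a) The route's documented rank-one rung (lens-2 g3 `RationalCubePiKernelSingleRankOne`, census row K18a; route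
rationale: «linear rank 1 all m reduced to RankOnePushforward (move bookkeeping) ∧ DimLeOneKernel (tree theorem)»)
is now a THEOREM with no pushforward hypothesis — verbatim statement, proved from Theorem I by a different mechanism
(transversal Stokes descent on the fixed cube instead of the shear pushforward).
(b) CORNER criterion at m = 2 for grid denominators `Q = (x + a)(y + b)`: `H²_dR(𝔸² ∖ {Q=0}) = ℚ·[dx∧dy/Q]` with the
functional `P ↦ P(−a,−b)`; constructively, `P(−a,−b) = 0 ⟹ P = (x+a)F + (y+b)G ⟹ P/Q = ∂_x(Φ/(y+b)) + ∂_y(Ψ/(x+a))`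
(`∂_xΦ = F`, `∂_yΨ = G`) ⟹ exact ⟹ DECIDED (N = 0). The residual for this `Q` is the ONE-parameter family
`P(−a,−b) ≠ 0` (value `= P(−a,−b)·log((1+a)/a)·log((1+b)/b) +` Baker-type terms; e.g. `(log 2)²` for `a = b = 1`),
whose decision is Schanuel-strength. -/

/-- **(a) The rank-one rung of the route, verbatim (lens-2 g3 `RationalCubePiKernelSingleRankOne`), PROVED.**
[cite: KontsevichZagier2001, §1.2] -/
theorem rationalCubePiKernelSingleRankOne_holds :
    ∀ (m : ℕ) (q : IntegralRep m) (P : MvPolynomial (Fin m) ℚ) (ℓ : Fin m → ℚ) (g : Polynomial ℚ),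
    q.domain = Set.pi Set.univ (fun _ : Fin m => Set.Icc (0:ℝ) 1) →
    (∀ z ∈ Set.pi Set.univ (fun _ : Fin m => Set.Icc (0:ℝ) 1),
        aeval z (Polynomial.aeval (∑ i, C (ℓ i) * X i : MvPolynomial (Fin m) ℚ) g) ≠ 0) →
    (∀ z ∈ Set.pi Set.univ (fun _ : Fin m => Set.Icc (0:ℝ) 1),
        q.integrand z = aeval z P / aeval z (Polynomial.aeval (∑ i, C (ℓ i) * X i : MvPolynomial (Fin m) ℚ) g)) →
    q.value = 0 → of q ∈ relations := by
  intro m q P ℓ g hd hQ hf h0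
  exact rankLeOneKernel_holds m q P _ g 0 ℓ (by rw [map_zero, zero_add]) hd hQ hf h0

/-- Constants of `ℚ[x_∅]` pushed into two more variables are constants. [folklore] -/
theorem rename_succ_rename_succ_fin0 (r : MvPolynomial (Fin 0) ℚ) :
    rename Fin.succ (rename Fin.succ r : MvPolynomial (Fin 1) ℚ) = (C (r.coeff 0) : MvPolynomial (Fin 2) ℚ) := by
  conv_lhs => rw [eq_C_of_isEmpty r]
  rw [rename_C, rename_C]

/-- **(b) Corner decomposition**: `P = (x + a)·F + (y + b)·G + P(−a,−b)`. [folklore] -/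
theorem exists_corner_div (a b : ℚ) (P : MvPolynomial (Fin 2) ℚ) :
    ∃ (F G : MvPolynomial (Fin 2) ℚ) (r : ℚ), P = (X 0 + C a) * F + (X 1 + C b) * G + C r := by
  obtain ⟨F, ρ, hP⟩ := exists_monicLinear_div (C a : MvPolynomial (Fin 1) ℚ) P
  obtain ⟨G, r, hρ⟩ := exists_monicLinear_div (C b : MvPolynomial (Fin 0) ℚ) ρ
  refine ⟨F, rename Fin.succ G, r.coeff 0, ?_⟩
  rw [hP, hρ, rename_C, map_add, map_mul, map_add, rename_X, rename_C, rename_succ_rename_succ_fin0]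
  have h1 : (Fin.succ (0 : Fin 1) : Fin 2) = 1 := rfl
  rw [h1]
  simp only [rename_C]
  ring

/-- The constant of the corner decomposition is the corner value. [folklore] -/
theorem corner_const_eq {a b : ℚ} {P F G : MvPolynomial (Fin 2) ℚ} {r : ℚ}
    (h : P = (X 0 + C a) * F + (X 1 + C b) * G + C r) :
    MvPolynomial.eval ![-a, -b] P = r := by
  rw [h]
  simp

/-- **Corner-vanishing numerators over a grid denominator are exact.** [folklore] -/
theorem drExact_of_corner (a b : ℚ) (P : MvPolynomial (Fin 2) ℚ) (hP : MvPolynomial.eval ![-a, -b] P = 0) :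
    DRExact P ((X 0 + C a) * (X 1 + C b)) := by
  obtain ⟨F, G, r, h⟩ := exists_corner_div a b P
  have hr : r = 0 := by rw [← corner_const_eq h, hP]
  rw [hr, map_zero, add_zero] at h
  obtain ⟨Φ, hΦ⟩ := exists_pderiv_eq (0 : Fin 2) F
  obtain ⟨Ψ, hΨ⟩ := exists_pderiv_eq (1 : Fin 2) G
  refine ⟨0, ![Φ * (X 0 + C a), Ψ * (X 1 + C b)], ?_⟩
  simp only [Fin.sum_univ_two, Matrix.cons_val_zero, Matrix.cons_val_one, Nat.cast_zero, zero_add, map_one,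
    one_mul, pow_one, map_add, Derivation.leibniz, smul_eq_mul, pderiv_X_self, pderiv_C,
    pderiv_one_X_zero, pderiv_zero_X_one, hΦ, hΨ, add_zero, mul_zero, mul_one, zero_add]
  rw [h]
  ring

/-- **DECIDED (m = 2, PROVED, N = 0): grid denominators, corner-vanishing numerators.**
`[ [0,1]², P/((x+a)(y+b)) ]` with `P(−a,−b) = 0`, zero-free, value `0` ⟹ `∈ relations`. [cite: KontsevichZagier2001, §1.2] -/
theorem corner_two_mem_relations (a b : ℚ) (q : IntegralRep 2) (P : MvPolynomial (Fin 2) ℚ)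
    (hP : MvPolynomial.eval ![-a, -b] P = 0)
    (hd : q.domain = Set.pi Set.univ (fun _ : Fin 2 => Set.Icc (0:ℝ) 1))
    (hQ : ∀ z ∈ Set.pi Set.univ (fun _ : Fin 2 => Set.Icc (0:ℝ) 1),
      MvPolynomial.aeval z ((X 0 + C a) * (X 1 + C b)) ≠ 0)
    (hf : ∀ z ∈ Set.pi Set.univ (fun _ : Fin 2 => Set.Icc (0:ℝ) 1),
      q.integrand z = MvPolynomial.aeval z P / MvPolynomial.aeval z ((X 0 + C a) * (X 1 + C b)))
    (h0 : q.value = 0) : of q ∈ relations := by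
  obtain ⟨s, G, hid⟩ := drExact_of_corner a b P hP
  exact mem_relations_of_exact_two q P _ s G hid hd hQ hf h0

/-- The residual of 26322 on the grid denominator `(x+a)(y+b)`: numerators with NON-ZERO corner value
(one parameter; value `= P(−a,−b)·log((1+a)/a)·log((1+b)/b) + weight ≤ 1`). [folklore] -/
def CornerResidual (a b : ℚ) : Prop :=
  ∀ (q : IntegralRep 2) (P : MvPolynomial (Fin 2) ℚ), MvPolynomial.eval ![-a, -b] P ≠ 0 →
    q.domain = Set.pi Set.univ (fun _ : Fin 2 => Set.Icc (0:ℝ) 1) →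
    (∀ z ∈ Set.pi Set.univ (fun _ : Fin 2 => Set.Icc (0:ℝ) 1),
      MvPolynomial.aeval z ((X 0 + C a) * (X 1 + C b)) ≠ 0) →
    (∀ z ∈ Set.pi Set.univ (fun _ : Fin 2 => Set.Icc (0:ℝ) 1),
      q.integrand z = MvPolynomial.aeval z P / MvPolynomial.aeval z ((X 0 + C a) * (X 1 + C b))) →
    q.value = 0 → ∃ N : ℕ, (fun y : FormalRep => of piRep * y)^[N] (of q) ∈ relations

/-- **26322 on a grid denominator ⟸ its one-parameter corner residual (PROVED split).** [folklore] -/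
theorem grid_single_of_cornerResidual (a b : ℚ) (h : CornerResidual a b) (q : IntegralRep 2)
    (P : MvPolynomial (Fin 2) ℚ)
    (hd : q.domain = Set.pi Set.univ (fun _ : Fin 2 => Set.Icc (0:ℝ) 1))
    (hQ : ∀ z ∈ Set.pi Set.univ (fun _ : Fin 2 => Set.Icc (0:ℝ) 1),
      MvPolynomial.aeval z ((X 0 + C a) * (X 1 + C b)) ≠ 0)
    (hf : ∀ z ∈ Set.pi Set.univ (fun _ : Fin 2 => Set.Icc (0:ℝ) 1),
      q.integrand z = MvPolynomial.aeval z P / MvPolynomial.aeval z ((X 0 + C a) * (X 1 + C b)))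
    (h0 : q.value = 0) : ∃ N : ℕ, (fun y : FormalRep => of piRep * y)^[N] (of q) ∈ relations := by
  by_cases hP : MvPolynomial.eval ![-a, -b] P = 0
  · exact ⟨0, by simpa using corner_two_mem_relations a b q P hP hd hQ hf h0⟩
  · exact h q P hP hd hQ hf h0

end Summit.KontsevichZagierPeriods.RootDecompRationalCubeDichotomy.Rung26322.RankDescent
end
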